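/-
Copyright: statement-level skeleton of a published paper (lit-balaban cell, Phase-2 proof seat p39 gen 18). No proof claims
beyond what the kernel checks below.
-/
import Literature.MathematicalPhysics.QuantumFieldTheory.Balaban1983to89.B3Ineq313Lattice
import Literature.MathematicalPhysics.QuantumFieldTheory.Balaban1983to89.B3SubtractionAlphaGain
import Literature.MathematicalPhysics.QuantumFieldTheory.Balaban1983to89.B3

/-!
# Bałaban, *(Higgs)₂,₃ quantum fields in a finite volume. III*, CMP 88 (1983): (3.33), (3.34), (3.36) and the first paragraph
# of p. 444 ON THE PRINT'S CARRIER `ηℤ^{d+1}` — the two-scalar-one-vector-leg graphs, the transport of the legs to one vertex,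
# *"a convergent expression plus the expression (3.36)"*, the move of the localization functions, and the summation of (3.36)
# over the line indices

[cite: Balaban1983Higgs3, (3.33)–(3.34) p.443 (PDF 33); (3.36) p.444 (PDF 34)].  Unit `lit-balaban-p39-g18` (Phase-2 proof seat p39,
gen 18); fold row `B3.Eq3.33-3.38` (owner r15).  statement-level skeleton of published theorems with citation tags; proofs where
landed; nothing here is a claim about the Yang–Mills mass gap.
v1.1 (p39 gen 22, 2026-08-23; DOC-ONLY, declarations byte-identical to v1.0 p350986; summit-lit1 g87 CITELOC #23 key
P87-002 + referee ref-1 g79 record-only note): (3.33)/(3.34) are printed on p. 443 [PDF 33] (p. 444 opens with «the corresponding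
vertex. This gives us a convergent expression plus the expression (3.36)»); the one tag of v1.0 that attached (3.34) to page 444
(docstring of `abs_convergent334Z_le`) now reads «(3.34) p.443; p.444».  The p. 444 quotes restore the printed η superscripts:
«propagators G^η_{j₀}(0), G^η_{j₀}, where j₀ is the lowest index of the external legs» (render p034 read).  Nothing else changed.

PDF held: `paper:balaban1983-higgs-2-3-quantum-fields-finite-volume` (journal page = PDF page + 410); pp. 443–444 read in the OCR text
(`p0033.txt`, `p0034.txt` of `lit read`) and on the ×2 render
`run/shared/lean/pub/pub-balaban/b2b-balaban-ref1/pages/1983-cmp88-higgs23-III/1983-cmp88-higgs23-III-p033-x2.png`.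

THE PRINTED TEXT (verbatim).  p. 443: *"Thus we have to consider the graphs (2.18)–(2.20), (2.21b), and the counterterms (2.21g) and
(2.21c). Only the first three classes are primitively divergent. Generally an expression corresponding to these graphs has the form
Σ_{x,x′,x″} η^{3d} Σ_{μ=1}^d g(x)A_μ(x)φ′(x′)·Γ_μ(x,x′,x″)φ″(x″) (3.33) and the degree is 0. We transform this expression transporting all
the legs to one vertex. More precisely we transport the legs with the lowest j-indices to a vertex having a leg with highest index. For
example, if φ′ is such a leg, then (3.33) = Σ_{x,x′,x″} η^{3d} Σ_{μ=1}^d [ (g(x)A_μ(x) − g(x′)A_μ(x′))/|x−x′|^α φ′(x′)·Γ_μ(x,x′,x″)|x−x′|^α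
φ″(x″) + g(x′)A_μ(x′)φ′(x′)·Γ_μ(x,x′,x″)|x″−x′|^α (φ″(x″) − φ″(x′))/|x″−x′|^α ] + Σ_{x′} η^d Σ_{μ=1}^d g(x′)A_μ(x′)φ′(x′)·(Σ_{x,x″}
η^{2d}Γ_μ(x,x′,x″)) φ″(x′). (3.34) … This way all the expressions on the right side of (3.34) are convergent, except the first two. We
transform further this expression moving all localization functions to the corresponding vertex."*  p. 444: *"This gives us a convergent
expression plus the expression Σ_{x′} η^d Σ_{μ=1}^d g(x′)A_μ(x′)φ′(x′) (a product of the values of all the localization functions at the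
point x′)(Σ_{x,x″} η^{2d}Γ′_μ(x,x′,x″)) φ″(x′), (3.36) where Γ′_μ is given by the same formula as before, but with the summations
unrestricted. Next we sum the expressions (3.36) over admissible orderings and indices and we get the expressions of the same type but
with propagators G^η_{j₀}(0), G^η_{j₀}, where j₀ is the lowest index of the external legs."*

THE CARRIER.  The print's carrier for (3.4)–(3.38) is the zero-field infinite lattice (pp. 433–434: *"with the scalar field propagator
equal to G_k(0)"*, *"We apply the decomposition (2.6) to the propagators G_k(0), G_k"*; ROWS-B3 v1.207).  The TORUS files of record of
this row are r15's `B3Sect3TriangleGraphs` §1 (`tripleSum`, `expr333`, `eq334`, `local334`, `local336`), p20 g3's `B3TriangleAlphaGain`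
(`abs_tripleSum_le`, `abs_convergent334_le`) and p20 g5's `B3Resummation336` (`locKernel`, `moveRem`, `local334_locKernel`,
`abs_local334_moveRem_le`, `local336_resum`, `triKernel`).  THIS FILE is their `ℤ^{d+1}` twin — same architecture and names with the
suffix `Z` — in the vocabulary of p26 g34's lattice chain (`B3Ineq313Lattice.KernelZ`, `B3Taylor310Lattice.dist₁`; sums over explicit
finite localization sets `Λ ∋ x`, `Λ′ ∋ x′`, `Λ″ ∋ x″`, as in p26's (3.9)/(3.11), p40's (3.22) and p39's (3.26) lattice files); p20 g3's
elementary gain `B3SubtractionAlphaGain.exp_mul_rpow_le` and the (2.6) display `B3.Display26` are used BY NAME.  Nothing of another seat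
is modified.

DISPLAY ↦ DECLARATION (the owner's audit table).
* (3.33) ↦ `tripleSumZ` (the generic three-point pairing), **`expr333Z`** (def with body).
* (3.34) ↦ **`eq334Z`** PROVED WITH NO HYPOTHESIS (`η > 0`, any real `α`, weight `|x − x′| = η·dist₁`), generic-weight form
  `eq334Z_of_weights`; its local (last) term **`local334Z`** (`tripleSumZ_local`).
* p. 444 *"This gives us a convergent expression"* for the two transported terms ↦ **`abs_convergent334Z_le`** (and the two terms
  separately, `abs_tripleSumZ_first_le` / `abs_tripleSumZ_second_le`; generic termwise majorisation `abs_tripleSumZ_le`): under a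
  TWO-SCALE tree bound of `Γ` through the vertex `x′` (scale `s₁` on the line `x–x′`, `s₂` on the line `x′–x″`) and Hölder/sup bounds of
  the transported legs, the two terms are bounded by `(d+1)·K·(H₁B₂s₁^α + B₁H₂s₂^α)·(1 + 2/δ)` times the degree-0 majorant
  `Σ η^{3(d+1)}‖φ′(x′)‖e^{−½δη|x−x′|₁/s₁}e^{−½δη|x′−x″|₁/s₂}` (gain `s^α`: degree `+α`).
* p. 444 *"moving all localization functions to the corresponding vertex … a convergent expression plus the expression (3.36)"* ↦
  `locKernelZ`, `moveRemZ`, the exact identity **`local334Z_locKernelZ`**, the bound **`abs_local334Z_moveRemZ_le`**.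
* (3.36) ↦ **`local336Z`** (def with body; `locs x′` = the product of the values of all localization functions at `x′`).
* p. 444 *"we sum the expressions (3.36) over admissible orderings and indices and we get the expressions of the same type but with
  propagators G^η_{j₀}(0), G^η_{j₀}"* ↦ **`local336Z_resum`** (every multilinear dependence of `Γ′` on the line kernels; (2.6) per line as
  `B3.Display26`), the three-line triangle shape `triKernelZ` with `triKernelZ_sum`, **`local336Z_triKernelZ_resum`**, and the tree bound
  of a triangle kernel from line bounds `norm_triKernelZ_le` (the shape of the hypothesis `hΓ` of the estimates above).

HONEST SCOPE / DECLARED DIVERGENCES (F7).  (i) ZERO BACKGROUND (the §3 setting, p. 433), scalar legs with values in a real inner-product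
space `W` (print: `ℝ^N`), `Γ_μ(x,x′,x″)` acting on `W` linearly; real vector legs `A μ x = A_μ(x)`.  (ii) `|x − x′| = η·dist₁(x,x′)` (p26's
`ℓ¹` lattice distance; print: unspecified norm).  (iii) The sums run over explicit finite localization sets `Λ, Λ′, Λ″` (the supports of the
localization functions; the print's *"summations unrestricted"* for `Γ′` concerns the internal vertices of `Γ′`, which are inside the
kernel slot here).  (iv) The kernel tree bound and the Hölder/sup bounds of the legs are HYPOTHESES in this file (rows B3.Eq2.10–2.12,
p. 420 localizations); the companion file `B3Eq334ZeroLatticePieces` discharges the kernel bound for triangle kernels built from the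
(2.6)-pieces of `G_k(ηℤ^{d+1}, 0)` and instantiates the resummation at `Σ_{j<n}G^η_{(j)}(0)`.  (v) The admissibility bookkeeping of the
orderings (row B3.Eq2.7) is not re-derived: the index sum is over all of `[0, j₀)^m`, as in the torus files.  (vi) NOT treated: the
pictures (3.35), the vanishing sentences for (2.21b)/(2.21g)/(2.18)/(2.21c), (3.37)/(3.38) (r15 `B3Sect3TriangleGraphs` §2, p39 g10
`B3Eq337ZeroLattice`/`B3Eq338ZeroLattice` on `ξℤ³`), `d = 2`-specific statements.  Definitions with bodies and theorems only; no
Literature fact minted, no `sorry`; standard axioms.  Value = (3.33)/(3.34)/(3.36) and the p. 444 paragraph on the printed carrier, NOT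
summit progress.  HOME `run/shared/lean/pub/lit-balaban/` (row B3.Eq3.33-3.38, FILED.md, STATUS.md), 2026-08-23.
-/

open scoped BigOperators RealInnerProductSpace

namespace Literature.MathematicalPhysics.QuantumFieldTheory.Balaban1983to89.B3Eq334ZeroLattice

open B3Taylor310Lattice (dist₁ dist₁_comm dist₁_self)
open B3Ineq313Lattice (KernelZ)
open B3SubtractionAlphaGain (exp_mul_rpow_le)

noncomputable section

variable {d : ℕ} {W : Type*} [NormedAddCommGroup W] [InnerProductSpace ℝ W]

/-! ## §1 (3.33), (3.34), (3.36) on `ηℤ^{d+1}` -/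

section Displays

/-- The three-point kernels `Γ_μ(x,x′,x″)` of (3.33) on `ηℤ^{d+1}`, acting linearly on the internal indices of the scalar legs (twin of
r15's torus `B3Sect3TriangleGraphs.Kernel3`). [cite: Balaban1983Higgs3, (3.33) p.443] -/
abbrev Kernel3Z (d : ℕ) (W : Type*) [NormedAddCommGroup W] [InnerProductSpace ℝ W] : Type _ :=
  Fin (d + 1) → (Fin (d + 1) → ℤ) → (Fin (d + 1) → ℤ) → (Fin (d + 1) → ℤ) → (W →ₗ[ℝ] W)

/-- The generic three-point pairing behind (3.33)/(3.34) on `ηℤ^{d+1}` with finite localization sets `Λ ∋ x`, `Λ′ ∋ x′`, `Λ″ ∋ x″`: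
`Σ_{x∈Λ,x′∈Λ′,x″∈Λ″} η^{3d} Σ_μ F_μ(x,x′)·φ′(x′)·Γ_μ(x,x′,x″)H(x,x′,x″)` — the vector leg read by `F` (`g(x)A_μ(x)` in (3.33), the transported
readings in (3.34)), the second scalar leg by `H` (`φ″(x″)` in (3.33)). [cite: Balaban1983Higgs3, (3.33) p.443] -/
def tripleSumZ (η : ℝ) (Γ : Kernel3Z d W) (F : Fin (d + 1) → (Fin (d + 1) → ℤ) → (Fin (d + 1) → ℤ) → ℝ)
    (φ' : (Fin (d + 1) → ℤ) → W) (H : (Fin (d + 1) → ℤ) → (Fin (d + 1) → ℤ) → (Fin (d + 1) → ℤ) → W)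
    (Λ Λ' Λ'' : Finset (Fin (d + 1) → ℤ)) : ℝ :=
  ∑ x ∈ Λ, ∑ x' ∈ Λ', ∑ x'' ∈ Λ'', η ^ (3 * (d + 1)) *
    ∑ μ : Fin (d + 1), F μ x x' * ⟪φ' x', Γ μ x x' x'' (H x x' x'')⟫

/-- **(3.33)** p. 443 [PDF 33] ON `ηℤ^{d+1}`, verbatim: *"Σ_{x,x′,x″} η^{3d} Σ_{μ=1}^d g(x)A_μ(x)φ′(x′)·Γ_μ(x,x′,x″)φ″(x″) (3.33)"* (vector leg
`A μ x = A_μ(x)`, localization sets `Λ, Λ′, Λ″`). [cite: Balaban1983Higgs3, (3.33) p.443] -/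
def expr333Z (η : ℝ) (Γ : Kernel3Z d W) (g : (Fin (d + 1) → ℤ) → ℝ) (A : Fin (d + 1) → (Fin (d + 1) → ℤ) → ℝ)
    (φ' φ'' : (Fin (d + 1) → ℤ) → W) (Λ Λ' Λ'' : Finset (Fin (d + 1) → ℤ)) : ℝ :=
  tripleSumZ η Γ (fun μ x _ => g x * A μ x) φ' (fun _ _ x'' => φ'' x'') Λ Λ' Λ''

/-- The local (last) term of **(3.34)** p. 443 on `ηℤ^{d+1}`: `Σ_{x′∈Λ′}η^dΣ_μ g(x′)A_μ(x′)φ′(x′)·(Σ_{x∈Λ,x″∈Λ″}η^{2d}Γ_μ(x,x′,x″))φ″(x′)`.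
[cite: Balaban1983Higgs3, (3.34) p.443] -/
def local334Z (η : ℝ) (Γ : Kernel3Z d W) (g : (Fin (d + 1) → ℤ) → ℝ) (A : Fin (d + 1) → (Fin (d + 1) → ℤ) → ℝ)
    (φ' φ'' : (Fin (d + 1) → ℤ) → W) (Λ Λ' Λ'' : Finset (Fin (d + 1) → ℤ)) : ℝ :=
  ∑ x' ∈ Λ', η ^ (d + 1) * ∑ μ : Fin (d + 1), g x' * A μ x' *
    ⟪φ' x', (∑ x ∈ Λ, ∑ x'' ∈ Λ'', η ^ (2 * (d + 1)) • Γ μ x x' x'') (φ'' x')⟫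

/-- **(3.36)** p. 444 [PDF 34] ON `ηℤ^{d+1}`: the same local term with the unrestricted kernel `Γ′_μ` and the product `locs x′` of the
values of all the localization functions at `x′` in place of `g(x′)`:
`Σ_{x′}η^dΣ_μ locs(x′)A_μ(x′)φ′(x′)·(Σ_{x,x″}η^{2d}Γ′_μ(x,x′,x″))φ″(x′)`. [cite: Balaban1983Higgs3, (3.36) p.444] -/
def local336Z (η : ℝ) (Γ' : Kernel3Z d W) (locs : (Fin (d + 1) → ℤ) → ℝ) (A : Fin (d + 1) → (Fin (d + 1) → ℤ) → ℝ)
    (φ' φ'' : (Fin (d + 1) → ℤ) → W) (Λ Λ' Λ'' : Finset (Fin (d + 1) → ℤ)) : ℝ :=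
  local334Z η Γ' locs A φ' φ'' Λ Λ' Λ''

/-- `η^{3d} = η^d·η^{2d}`. [folklore] -/
private theorem pow_three_mul' (η : ℝ) (n : ℕ) : η ^ (3 * n) = η ^ n * η ^ (2 * n) := by
  rw [← pow_add]
  congr 1
  ring

/-- kernel: the pairing is additive in the second-leg reading `H`. [cite: Balaban1983Higgs3, (3.34) p.443] -/
theorem tripleSumZ_add_H (η : ℝ) (Γ : Kernel3Z d W) (F : Fin (d + 1) → (Fin (d + 1) → ℤ) → (Fin (d + 1) → ℤ) → ℝ)
    (φ' : (Fin (d + 1) → ℤ) → W) (H H' : (Fin (d + 1) → ℤ) → (Fin (d + 1) → ℤ) → (Fin (d + 1) → ℤ) → W)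
    (Λ Λ' Λ'' : Finset (Fin (d + 1) → ℤ)) :
    tripleSumZ η Γ F φ' (fun x x' x'' => H x x' x'' + H' x x' x'') Λ Λ' Λ'' =
      tripleSumZ η Γ F φ' H Λ Λ' Λ'' + tripleSumZ η Γ F φ' H' Λ Λ' Λ'' := by
  simp only [tripleSumZ, map_add, inner_add_right, mul_add, Finset.sum_add_distrib]

/-- kernel: the local reading (both legs at `x′`) of the pairing collapses the `x, x″` sums onto the kernel — the last term of (3.34).
[cite: Balaban1983Higgs3, (3.34) p.443] -/
theorem tripleSumZ_local (η : ℝ) (Γ : Kernel3Z d W) (g : (Fin (d + 1) → ℤ) → ℝ) (A : Fin (d + 1) → (Fin (d + 1) → ℤ) → ℝ)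
    (φ' φ'' : (Fin (d + 1) → ℤ) → W) (Λ Λ' Λ'' : Finset (Fin (d + 1) → ℤ)) :
    tripleSumZ η Γ (fun μ _ x' => g x' * A μ x') φ' (fun _ x' _ => φ'' x') Λ Λ' Λ'' = local334Z η Γ g A φ' φ'' Λ Λ' Λ'' := by
  have hR : local334Z η Γ g A φ' φ'' Λ Λ' Λ'' = ∑ x' ∈ Λ', ∑ μ : Fin (d + 1), ∑ x ∈ Λ, ∑ x'' ∈ Λ'',
      η ^ (3 * (d + 1)) * (g x' * A μ x' * ⟪φ' x', Γ μ x x' x'' (φ'' x')⟫) := by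
    simp only [local334Z, LinearMap.sum_apply, LinearMap.smul_apply, inner_sum, inner_smul_right, Finset.mul_sum]
    refine Finset.sum_congr rfl fun x' _ => Finset.sum_congr rfl fun μ _ =>
      Finset.sum_congr rfl fun x _ => Finset.sum_congr rfl fun x'' _ => ?_
    rw [pow_three_mul']
    ring
  have hL : tripleSumZ η Γ (fun μ _ x' => g x' * A μ x') φ' (fun _ x' _ => φ'' x') Λ Λ' Λ'' =
      ∑ x ∈ Λ, ∑ x' ∈ Λ', ∑ x'' ∈ Λ'', ∑ μ : Fin (d + 1),
        η ^ (3 * (d + 1)) * (g x' * A μ x' * ⟪φ' x', Γ μ x x' x'' (φ'' x')⟫) := by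
    simp only [tripleSumZ, Finset.mul_sum]
  rw [hL, hR]
  calc (∑ x ∈ Λ, ∑ x' ∈ Λ', ∑ x'' ∈ Λ'', ∑ μ : Fin (d + 1),
        η ^ (3 * (d + 1)) * (g x' * A μ x' * ⟪φ' x', Γ μ x x' x'' (φ'' x')⟫))
      = ∑ x' ∈ Λ', ∑ x ∈ Λ, ∑ x'' ∈ Λ'', ∑ μ : Fin (d + 1),
        η ^ (3 * (d + 1)) * (g x' * A μ x' * ⟪φ' x', Γ μ x x' x'' (φ'' x')⟫) := Finset.sum_comm
    _ = ∑ x' ∈ Λ', ∑ x ∈ Λ, ∑ μ : Fin (d + 1), ∑ x'' ∈ Λ'',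
        η ^ (3 * (d + 1)) * (g x' * A μ x' * ⟪φ' x', Γ μ x x' x'' (φ'' x')⟫) :=
        Finset.sum_congr rfl fun x' _ => Finset.sum_congr rfl fun x _ => Finset.sum_comm
    _ = ∑ x' ∈ Λ', ∑ μ : Fin (d + 1), ∑ x ∈ Λ, ∑ x'' ∈ Λ'',
        η ^ (3 * (d + 1)) * (g x' * A μ x' * ⟪φ' x', Γ μ x x' x'' (φ'' x')⟫) :=
        Finset.sum_congr rfl fun x' _ => Finset.sum_comm

/-- **(3.34)** p. 443 [PDF 33] ON `ηℤ^{d+1}`, generic form — PROVED for any two weights vanishing only on the diagonal (in print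
`w₁(x,x′) = |x−x′|^α`, `w₂(x″,x′) = |x″−x′|^α`): (3.33) = Σ η^{3d}Σ_μ[ (gA_μ(x) − gA_μ(x′))/w₁ φ′(x′)·Γ w₁φ″(x″) + gA_μ(x′)φ′(x′)·Γ w₂(φ″(x″) −
φ″(x′))/w₂ ] + (local term). [cite: Balaban1983Higgs3, (3.34) p.443] -/
theorem eq334Z_of_weights (η : ℝ) (Γ : Kernel3Z d W) (g : (Fin (d + 1) → ℤ) → ℝ) (A : Fin (d + 1) → (Fin (d + 1) → ℤ) → ℝ)
    (φ' φ'' : (Fin (d + 1) → ℤ) → W) (w₁ w₂ : (Fin (d + 1) → ℤ) → (Fin (d + 1) → ℤ) → ℝ)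
    (hw₁ : ∀ x x', w₁ x x' = 0 → x = x') (hw₂ : ∀ x x', w₂ x x' = 0 → x = x') (Λ Λ' Λ'' : Finset (Fin (d + 1) → ℤ)) :
    expr333Z η Γ g A φ' φ'' Λ Λ' Λ'' =
      tripleSumZ η Γ (fun μ x x' => (g x * A μ x - g x' * A μ x') / w₁ x x') φ' (fun x x' x'' => w₁ x x' • φ'' x'') Λ Λ' Λ'' +
        tripleSumZ η Γ (fun μ _ x' => g x' * A μ x') φ'
          (fun _ x' x'' => w₂ x'' x' • ((w₂ x'' x')⁻¹ • (φ'' x'' - φ'' x'))) Λ Λ' Λ'' +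
        local334Z η Γ g A φ' φ'' Λ Λ' Λ'' := by
  rw [← tripleSumZ_local, add_assoc, ← tripleSumZ_add_H]
  simp only [expr333Z, tripleSumZ]
  rw [← Finset.sum_add_distrib]
  refine Finset.sum_congr rfl fun x _ => ?_
  rw [← Finset.sum_add_distrib]
  refine Finset.sum_congr rfl fun x' _ => ?_
  rw [← Finset.sum_add_distrib]
  refine Finset.sum_congr rfl fun x'' _ => ?_
  rw [← mul_add, ← Finset.sum_add_distrib]
  congr 1
  refine Finset.sum_congr rfl fun μ _ => ?_
  -- the two transports, pointwise
  have h2 : w₂ x'' x' • ((w₂ x'' x')⁻¹ • (φ'' x'' - φ'' x')) + φ'' x' = φ'' x'' := by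
    by_cases h0 : w₂ x'' x' = 0
    · have hx := hw₂ x'' x' h0
      subst hx
      rw [sub_self, smul_zero, smul_zero, zero_add]
    · rw [smul_smul, mul_inv_cancel₀ h0, one_smul, sub_add_cancel]
  rw [h2, map_smul, inner_smul_right]
  by_cases h1 : w₁ x x' = 0
  · have hx := hw₁ x x' h1
    subst hx
    rw [sub_self, zero_div, zero_mul, zero_add]
  · rw [← mul_assoc, div_mul_cancel₀ _ h1]
    ring

/-- kernel: `ℓ¹`-distance zero means equality. [folklore] -/
private theorem eq_of_dist₁_eq_zero {x x' : Fin (d + 1) → ℤ} (h : dist₁ x x' = 0) : x = x' := by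
  funext μ
  have hμ : (x μ - x' μ).natAbs = 0 := Finset.sum_eq_zero_iff.1 h μ (Finset.mem_univ μ)
  rw [Int.natAbs_eq_zero, sub_eq_zero] at hμ
  exact hμ

/-- kernel: the printed weight `|x−x′|^α = (η·dist₁)^α` vanishes only on the diagonal (`η > 0`). [folklore] -/
private theorem rpow_dist₁_eq_zero {η : ℝ} (hη : 0 < η) (α : ℝ) (x x' : Fin (d + 1) → ℤ)
    (h0 : (η * (dist₁ x x' : ℝ)) ^ α = 0) : x = x' := by
  have hnn : 0 ≤ η * (dist₁ x x' : ℝ) := by positivity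
  rw [Real.rpow_eq_zero_iff_of_nonneg hnn] at h0
  have h1 : (dist₁ x x' : ℝ) = 0 := by
    rcases mul_eq_zero.1 h0.1 with h2 | h2
    · exact absurd h2 hη.ne'
    · exact h2
  exact eq_of_dist₁_eq_zero (by exact_mod_cast h1)

/-- **(3.34)** p. 443 [PDF 33] ON THE PRINT'S CARRIER `ηℤ^{d+1}`, verbatim (see the module docstring) — PROVED WITH NO HYPOTHESIS, with
`|x−x′| = η·dist₁(x,x′)` (p26's `ℓ¹` lattice distance), `η > 0`, any real exponent `α`, finite localization sets (r15's torus `eq334` is the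
finite-volume twin). [cite: Balaban1983Higgs3, (3.34) p.443] -/
theorem eq334Z (η α : ℝ) (hη : 0 < η) (Γ : Kernel3Z d W) (g : (Fin (d + 1) → ℤ) → ℝ) (A : Fin (d + 1) → (Fin (d + 1) → ℤ) → ℝ)
    (φ' φ'' : (Fin (d + 1) → ℤ) → W) (Λ Λ' Λ'' : Finset (Fin (d + 1) → ℤ)) :
    expr333Z η Γ g A φ' φ'' Λ Λ' Λ'' =
      tripleSumZ η Γ (fun μ x x' => (g x * A μ x - g x' * A μ x') / (η * dist₁ x x') ^ α) φ'
          (fun x x' x'' => (η * dist₁ x x') ^ α • φ'' x'') Λ Λ' Λ'' +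
        tripleSumZ η Γ (fun μ _ x' => g x' * A μ x') φ'
          (fun _ x' x'' => (η * dist₁ x'' x') ^ α • (((η * dist₁ x'' x') ^ α)⁻¹ • (φ'' x'' - φ'' x'))) Λ Λ' Λ'' +
        local334Z η Γ g A φ' φ'' Λ Λ' Λ'' :=
  eq334Z_of_weights η Γ g A φ' φ'' (fun x x' => (η * dist₁ x x') ^ α) (fun x x' => (η * dist₁ x x') ^ α)
    (fun x x' h => rpow_dist₁_eq_zero hη α x x' h) (fun x x' h => rpow_dist₁_eq_zero hη α x x' h) Λ Λ' Λ''

end Displays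

/-! ## §2 *"This gives us a convergent expression"* — the two transported terms of (3.34) gain `s^α` -/

section Convergent

/-- kernel: in the FIRST transported term of (3.34) the weight cancels inside the pairing, for a weight `w` vanishing only on the
diagonal and a leg difference `D` vanishing on it. [cite: Balaban1983Higgs3, (3.34) p.443] -/
theorem tripleSumZ_weight_cancel_first (η : ℝ) (Γ : Kernel3Z d W) (φ' φ'' : (Fin (d + 1) → ℤ) → W)
    (w : (Fin (d + 1) → ℤ) → (Fin (d + 1) → ℤ) → ℝ) (hw : ∀ x x', w x x' = 0 → x = x')
    (D : Fin (d + 1) → (Fin (d + 1) → ℤ) → (Fin (d + 1) → ℤ) → ℝ) (hD : ∀ (μ : Fin (d + 1)) (x : Fin (d + 1) → ℤ), D μ x x = 0)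
    (Λ Λ' Λ'' : Finset (Fin (d + 1) → ℤ)) :
    tripleSumZ η Γ (fun μ x x' => D μ x x' / w x x') φ' (fun x x' x'' => w x x' • φ'' x'') Λ Λ' Λ'' =
      tripleSumZ η Γ D φ' (fun _ _ x'' => φ'' x'') Λ Λ' Λ'' := by
  unfold tripleSumZ
  refine Finset.sum_congr rfl fun x _ => Finset.sum_congr rfl fun x' _ => Finset.sum_congr rfl fun x'' _ => ?_
  congr 1
  refine Finset.sum_congr rfl fun μ _ => ?_
  beta_reduce
  rw [map_smul, inner_smul_right]
  by_cases h0 : w x x' = 0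
  · obtain rfl := hw x x' h0
    simp [hD]
  · rw [← mul_assoc, div_mul_cancel₀ _ h0]

/-- kernel: in the SECOND transported term of (3.34) the weight cancels — `w·(w⁻¹(φ″(x″) − φ″(x′))) = φ″(x″) − φ″(x′)` inside the
pairing, for a weight vanishing only on the diagonal. [cite: Balaban1983Higgs3, (3.34) p.443] -/
theorem tripleSumZ_weight_cancel_second (η : ℝ) (Γ : Kernel3Z d W) (F : Fin (d + 1) → (Fin (d + 1) → ℤ) → (Fin (d + 1) → ℤ) → ℝ)
    (φ' φ'' : (Fin (d + 1) → ℤ) → W) (w : (Fin (d + 1) → ℤ) → (Fin (d + 1) → ℤ) → ℝ) (hw : ∀ x x', w x x' = 0 → x = x')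
    (Λ Λ' Λ'' : Finset (Fin (d + 1) → ℤ)) :
    tripleSumZ η Γ F φ' (fun _ x' x'' => w x'' x' • ((w x'' x')⁻¹ • (φ'' x'' - φ'' x'))) Λ Λ' Λ'' =
      tripleSumZ η Γ F φ' (fun _ x' x'' => φ'' x'' - φ'' x') Λ Λ' Λ'' := by
  unfold tripleSumZ
  refine Finset.sum_congr rfl fun x _ => Finset.sum_congr rfl fun x' _ => Finset.sum_congr rfl fun x'' _ => ?_
  congr 1
  refine Finset.sum_congr rfl fun μ _ => ?_
  beta_reduce
  by_cases h0 : w x'' x' = 0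
  · obtain rfl := hw x'' x' h0
    simp
  · rw [smul_smul, mul_inv_cancel₀ h0, one_smul]

/-- kernel: termwise majorisation of the three-point pairing — if `|F_μ(x,x′)|·‖Γ_μ(x,x′,x″)H(x,x′,x″)‖ ≤ c·E(x,x′,x″)` for all `μ` and all
`x ∈ Λ`, `x′ ∈ Λ′`, `x″ ∈ Λ″`, then `|tripleSumZ| ≤ (d+1)·c·Σ_{x,x′,x″}η^{3(d+1)}‖φ′(x′)‖E(x,x′,x″)` (`η ≥ 0`).
[cite: Balaban1983Higgs3, (3.34) p.443] -/
theorem abs_tripleSumZ_le (η : ℝ) (hη : 0 ≤ η) (Γ : Kernel3Z d W) (F : Fin (d + 1) → (Fin (d + 1) → ℤ) → (Fin (d + 1) → ℤ) → ℝ)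
    (φ' : (Fin (d + 1) → ℤ) → W) (H : (Fin (d + 1) → ℤ) → (Fin (d + 1) → ℤ) → (Fin (d + 1) → ℤ) → W) (c : ℝ)
    (E : (Fin (d + 1) → ℤ) → (Fin (d + 1) → ℤ) → (Fin (d + 1) → ℤ) → ℝ) (Λ Λ' Λ'' : Finset (Fin (d + 1) → ℤ))
    (h : ∀ (μ : Fin (d + 1)), ∀ x ∈ Λ, ∀ x' ∈ Λ', ∀ x'' ∈ Λ'', |F μ x x'| * ‖Γ μ x x' x'' (H x x' x'')‖ ≤ c * E x x' x'') :
    |tripleSumZ η Γ F φ' H Λ Λ' Λ''| ≤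
      ((d + 1 : ℕ) : ℝ) * c * ∑ x ∈ Λ, ∑ x' ∈ Λ', ∑ x'' ∈ Λ'', η ^ (3 * (d + 1)) * (‖φ' x'‖ * E x x' x'') := by
  -- per (x, x′, x″): the μ-sum
  have hinner : ∀ x ∈ Λ, ∀ x' ∈ Λ', ∀ x'' ∈ Λ'',
      |η ^ (3 * (d + 1)) * ∑ μ : Fin (d + 1), F μ x x' * ⟪φ' x', Γ μ x x' x'' (H x x' x'')⟫| ≤
        ((d + 1 : ℕ) : ℝ) * c * (η ^ (3 * (d + 1)) * (‖φ' x'‖ * E x x' x'')) := by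
    intro x hx x' hx' x'' hx''
    rw [abs_mul, abs_of_nonneg (by positivity : (0 : ℝ) ≤ η ^ (3 * (d + 1)))]
    have hμ : ∀ μ : Fin (d + 1), |F μ x x' * ⟪φ' x', Γ μ x x' x'' (H x x' x'')⟫| ≤ ‖φ' x'‖ * (c * E x x' x'') := by
      intro μ
      rw [abs_mul]
      calc |F μ x x'| * |⟪φ' x', Γ μ x x' x'' (H x x' x'')⟫|
          ≤ |F μ x x'| * (‖φ' x'‖ * ‖Γ μ x x' x'' (H x x' x'')‖) :=
            mul_le_mul_of_nonneg_left (abs_real_inner_le_norm _ _) (abs_nonneg _)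
        _ = ‖φ' x'‖ * (|F μ x x'| * ‖Γ μ x x' x'' (H x x' x'')‖) := by ring
        _ ≤ ‖φ' x'‖ * (c * E x x' x'') := mul_le_mul_of_nonneg_left (h μ x hx x' hx' x'' hx'') (norm_nonneg _)
    have hsum : |∑ μ : Fin (d + 1), F μ x x' * ⟪φ' x', Γ μ x x' x'' (H x x' x'')⟫| ≤
        ∑ _μ : Fin (d + 1), ‖φ' x'‖ * (c * E x x' x'') :=
      (Finset.abs_sum_le_sum_abs _ _).trans (Finset.sum_le_sum fun μ _ => hμ μ)
    rw [Finset.sum_const, Finset.card_univ, Fintype.card_fin, nsmul_eq_mul] at hsum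
    calc η ^ (3 * (d + 1)) * |∑ μ : Fin (d + 1), F μ x x' * ⟪φ' x', Γ μ x x' x'' (H x x' x'')⟫|
        ≤ η ^ (3 * (d + 1)) * (((d + 1 : ℕ) : ℝ) * (‖φ' x'‖ * (c * E x x' x''))) :=
          mul_le_mul_of_nonneg_left hsum (by positivity)
      _ = ((d + 1 : ℕ) : ℝ) * c * (η ^ (3 * (d + 1)) * (‖φ' x'‖ * E x x' x'')) := by ring
  unfold tripleSumZ
  calc |∑ x ∈ Λ, ∑ x' ∈ Λ', ∑ x'' ∈ Λ'', η ^ (3 * (d + 1)) *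
          ∑ μ : Fin (d + 1), F μ x x' * ⟪φ' x', Γ μ x x' x'' (H x x' x'')⟫|
      ≤ ∑ x ∈ Λ, |∑ x' ∈ Λ', ∑ x'' ∈ Λ'', η ^ (3 * (d + 1)) *
          ∑ μ : Fin (d + 1), F μ x x' * ⟪φ' x', Γ μ x x' x'' (H x x' x'')⟫| := Finset.abs_sum_le_sum_abs _ _
    _ ≤ ∑ x ∈ Λ, ∑ x' ∈ Λ', |∑ x'' ∈ Λ'', η ^ (3 * (d + 1)) *
          ∑ μ : Fin (d + 1), F μ x x' * ⟪φ' x', Γ μ x x' x'' (H x x' x'')⟫| :=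
        Finset.sum_le_sum fun x _ => Finset.abs_sum_le_sum_abs _ _
    _ ≤ ∑ x ∈ Λ, ∑ x' ∈ Λ', ∑ x'' ∈ Λ'', |η ^ (3 * (d + 1)) *
          ∑ μ : Fin (d + 1), F μ x x' * ⟪φ' x', Γ μ x x' x'' (H x x' x'')⟫| :=
        Finset.sum_le_sum fun x _ => Finset.sum_le_sum fun x' _ => Finset.abs_sum_le_sum_abs _ _
    _ ≤ ∑ x ∈ Λ, ∑ x' ∈ Λ', ∑ x'' ∈ Λ'', ((d + 1 : ℕ) : ℝ) * c * (η ^ (3 * (d + 1)) * (‖φ' x'‖ * E x x' x'')) :=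
        Finset.sum_le_sum fun x hx => Finset.sum_le_sum fun x' hx' => Finset.sum_le_sum fun x'' hx'' =>
          hinner x hx x' hx' x'' hx''
    _ = ((d + 1 : ℕ) : ℝ) * c * ∑ x ∈ Λ, ∑ x' ∈ Λ', ∑ x'' ∈ Λ'', η ^ (3 * (d + 1)) * (‖φ' x'‖ * E x x' x'') := by
        rw [Finset.mul_sum]
        refine Finset.sum_congr rfl fun x _ => ?_
        rw [Finset.mul_sum]
        refine Finset.sum_congr rfl fun x' _ => ?_
        rw [Finset.mul_sum]

/-- keeping half of an exponential factor costs nothing: `e^{−δu/s} ≤ e^{−½δu/s}` (`u ≥ 0`, `δ, s > 0`). [folklore] -/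
private theorem exp_le_exp_half {δ s u : ℝ} (hδ : 0 < δ) (hs : 0 < s) (hu : 0 ≤ u) :
    Real.exp (-(δ * s⁻¹ * u)) ≤ Real.exp (-(δ / 2 * s⁻¹ * u)) := by
  rw [Real.exp_le_exp]
  have : 0 ≤ δ / 2 * s⁻¹ * u := by positivity
  nlinarith

/-- **First transported term of (3.34) on `ηℤ^{d+1}` — quantitative bound, PROVED.**  With the two-scale tree bound through `x′`
`‖Γ_μ(x,x′,x″)v‖ ≤ Ke^{−δη|x−x′|₁/s₁}e^{−δη|x′−x″|₁/s₂}‖v‖`, the Hölder bound `|gA_μ(x) − gA_μ(x′)| ≤ H₁(η|x−x′|₁)^α` and `‖φ″‖ ≤ B₂` (on the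
localization sets), the first term is at most `(d+1)·K·H₁·B₂·(1 + 2/δ)·s₁^α·Σ η^{3(d+1)}‖φ′(x′)‖e^{−½δη|x−x′|₁/s₁}e^{−½δη|x′−x″|₁/s₂}` — the gain
`s₁^α` of the line along which the leg was transported. [cite: Balaban1983Higgs3, (3.34) p.443] -/
theorem abs_tripleSumZ_first_le (η : ℝ) (hη : 0 < η) {α H₁ B₂ K δ s₁ s₂ : ℝ} (hα0 : 0 ≤ α) (hα1 : α ≤ 1) (hH : 0 ≤ H₁)
    (hB : 0 ≤ B₂) (hK : 0 ≤ K) (hδ : 0 < δ) (hs₁ : 0 < s₁) (hs₂ : 0 < s₂) (Γ : Kernel3Z d W) (g : (Fin (d + 1) → ℤ) → ℝ)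
    (A : Fin (d + 1) → (Fin (d + 1) → ℤ) → ℝ) (φ' φ'' : (Fin (d + 1) → ℤ) → W) (Λ Λ' Λ'' : Finset (Fin (d + 1) → ℤ))
    (hΓ : ∀ (μ : Fin (d + 1)), ∀ x ∈ Λ, ∀ x' ∈ Λ', ∀ x'' ∈ Λ'', ∀ (v : W), ‖Γ μ x x' x'' v‖ ≤
      K * Real.exp (-(δ * s₁⁻¹ * (η * dist₁ x x'))) * Real.exp (-(δ * s₂⁻¹ * (η * dist₁ x' x''))) * ‖v‖)
    (hgA : ∀ (μ : Fin (d + 1)), ∀ x ∈ Λ, ∀ x' ∈ Λ', |g x * A μ x - g x' * A μ x'| ≤ H₁ * (η * dist₁ x x') ^ α)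
    (hφ'' : ∀ x'' ∈ Λ'', ‖φ'' x''‖ ≤ B₂) :
    |tripleSumZ η Γ (fun μ x x' => g x * A μ x - g x' * A μ x') φ' (fun _ _ x'' => φ'' x'') Λ Λ' Λ''| ≤
      ((d + 1 : ℕ) : ℝ) * (K * H₁ * B₂ * (1 + 2 / δ) * s₁ ^ α) *
        ∑ x ∈ Λ, ∑ x' ∈ Λ', ∑ x'' ∈ Λ'', η ^ (3 * (d + 1)) * (‖φ' x'‖ *
          (Real.exp (-(δ / 2 * s₁⁻¹ * (η * dist₁ x x'))) * Real.exp (-(δ / 2 * s₂⁻¹ * (η * dist₁ x' x''))))) := by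
  refine abs_tripleSumZ_le η hη.le Γ _ φ' _ (K * H₁ * B₂ * (1 + 2 / δ) * s₁ ^ α) _ Λ Λ' Λ''
    fun μ x hx x' hx' x'' hx'' => ?_
  set u₁ : ℝ := η * dist₁ x x' with hu₁
  set u₂ : ℝ := η * dist₁ x' x'' with hu₂
  have hu₁0 : 0 ≤ u₁ := mul_nonneg hη.le (Nat.cast_nonneg _)
  have hu₂0 : 0 ≤ u₂ := mul_nonneg hη.le (Nat.cast_nonneg _)
  have hw := exp_mul_rpow_le hδ hs₁ hu₁0 hα0 hα1
  have h2 := exp_le_exp_half hδ hs₂ hu₂0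
  have hΓv : ‖Γ μ x x' x'' (φ'' x'')‖ ≤ K * Real.exp (-(δ * s₁⁻¹ * u₁)) * Real.exp (-(δ * s₂⁻¹ * u₂)) * B₂ :=
    (hΓ μ x hx x' hx' x'' hx'' _).trans (mul_le_mul_of_nonneg_left (hφ'' x'' hx'') (by positivity))
  calc |g x * A μ x - g x' * A μ x'| * ‖Γ μ x x' x'' (φ'' x'')‖
      ≤ (H₁ * u₁ ^ α) * (K * Real.exp (-(δ * s₁⁻¹ * u₁)) * Real.exp (-(δ * s₂⁻¹ * u₂)) * B₂) :=
        mul_le_mul (hgA μ x hx x' hx') hΓv (norm_nonneg _) (by positivity)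
    _ = K * H₁ * B₂ * ((Real.exp (-(δ * s₁⁻¹ * u₁)) * u₁ ^ α) * Real.exp (-(δ * s₂⁻¹ * u₂))) := by ring
    _ ≤ K * H₁ * B₂ * (((1 + 2 / δ) * s₁ ^ α * Real.exp (-(δ / 2 * s₁⁻¹ * u₁))) * Real.exp (-(δ / 2 * s₂⁻¹ * u₂))) :=
        mul_le_mul_of_nonneg_left (mul_le_mul hw h2 (Real.exp_pos _).le (by positivity)) (by positivity)
    _ = K * H₁ * B₂ * (1 + 2 / δ) * s₁ ^ α *
          (Real.exp (-(δ / 2 * s₁⁻¹ * u₁)) * Real.exp (-(δ / 2 * s₂⁻¹ * u₂))) := by ring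

/-- **Second transported term of (3.34) on `ηℤ^{d+1}` — quantitative bound, PROVED.**  With the same two-scale tree bound on `Γ`, the
sup bound `|gA_μ(x′)| ≤ B₁` and the Hölder bound `‖φ″(x″) − φ″(x′)‖ ≤ H₂(η|x′−x″|₁)^α`, the second term is at most
`(d+1)·K·B₁·H₂·(1 + 2/δ)·s₂^α·Σ η^{3(d+1)}‖φ′(x′)‖e^{−½δη|x−x′|₁/s₁}e^{−½δη|x′−x″|₁/s₂}` — the gain `s₂^α` of the line `x′–x″`.
[cite: Balaban1983Higgs3, (3.34) p.443] -/
theorem abs_tripleSumZ_second_le (η : ℝ) (hη : 0 < η) {α B₁ H₂ K δ s₁ s₂ : ℝ} (hα0 : 0 ≤ α) (hα1 : α ≤ 1) (hB : 0 ≤ B₁)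
    (hH : 0 ≤ H₂) (hK : 0 ≤ K) (hδ : 0 < δ) (hs₁ : 0 < s₁) (hs₂ : 0 < s₂) (Γ : Kernel3Z d W) (g : (Fin (d + 1) → ℤ) → ℝ)
    (A : Fin (d + 1) → (Fin (d + 1) → ℤ) → ℝ) (φ' φ'' : (Fin (d + 1) → ℤ) → W) (Λ Λ' Λ'' : Finset (Fin (d + 1) → ℤ))
    (hΓ : ∀ (μ : Fin (d + 1)), ∀ x ∈ Λ, ∀ x' ∈ Λ', ∀ x'' ∈ Λ'', ∀ (v : W), ‖Γ μ x x' x'' v‖ ≤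
      K * Real.exp (-(δ * s₁⁻¹ * (η * dist₁ x x'))) * Real.exp (-(δ * s₂⁻¹ * (η * dist₁ x' x''))) * ‖v‖)
    (hgA : ∀ (μ : Fin (d + 1)), ∀ x' ∈ Λ', |g x' * A μ x'| ≤ B₁)
    (hφ'' : ∀ x' ∈ Λ', ∀ x'' ∈ Λ'', ‖φ'' x'' - φ'' x'‖ ≤ H₂ * (η * dist₁ x' x'') ^ α) :
    |tripleSumZ η Γ (fun μ _ x' => g x' * A μ x') φ' (fun _ x' x'' => φ'' x'' - φ'' x') Λ Λ' Λ''| ≤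
      ((d + 1 : ℕ) : ℝ) * (K * B₁ * H₂ * (1 + 2 / δ) * s₂ ^ α) *
        ∑ x ∈ Λ, ∑ x' ∈ Λ', ∑ x'' ∈ Λ'', η ^ (3 * (d + 1)) * (‖φ' x'‖ *
          (Real.exp (-(δ / 2 * s₁⁻¹ * (η * dist₁ x x'))) * Real.exp (-(δ / 2 * s₂⁻¹ * (η * dist₁ x' x''))))) := by
  refine abs_tripleSumZ_le η hη.le Γ _ φ' _ (K * B₁ * H₂ * (1 + 2 / δ) * s₂ ^ α) _ Λ Λ' Λ''
    fun μ x hx x' hx' x'' hx'' => ?_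
  set u₁ : ℝ := η * dist₁ x x' with hu₁
  set u₂ : ℝ := η * dist₁ x' x'' with hu₂
  have hu₁0 : 0 ≤ u₁ := mul_nonneg hη.le (Nat.cast_nonneg _)
  have hu₂0 : 0 ≤ u₂ := mul_nonneg hη.le (Nat.cast_nonneg _)
  have hw := exp_mul_rpow_le hδ hs₂ hu₂0 hα0 hα1
  have h1 := exp_le_exp_half hδ hs₁ hu₁0
  have hΓv : ‖Γ μ x x' x'' (φ'' x'' - φ'' x')‖ ≤
      K * Real.exp (-(δ * s₁⁻¹ * u₁)) * Real.exp (-(δ * s₂⁻¹ * u₂)) * (H₂ * u₂ ^ α) :=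
    (hΓ μ x hx x' hx' x'' hx'' _).trans (mul_le_mul_of_nonneg_left (hφ'' x' hx' x'' hx'') (by positivity))
  calc |g x' * A μ x'| * ‖Γ μ x x' x'' (φ'' x'' - φ'' x')‖
      ≤ B₁ * (K * Real.exp (-(δ * s₁⁻¹ * u₁)) * Real.exp (-(δ * s₂⁻¹ * u₂)) * (H₂ * u₂ ^ α)) :=
        mul_le_mul (hgA μ x' hx') hΓv (norm_nonneg _) hB
    _ = K * B₁ * H₂ * (Real.exp (-(δ * s₁⁻¹ * u₁)) * (Real.exp (-(δ * s₂⁻¹ * u₂)) * u₂ ^ α)) := by ring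
    _ ≤ K * B₁ * H₂ * (Real.exp (-(δ / 2 * s₁⁻¹ * u₁)) * ((1 + 2 / δ) * s₂ ^ α * Real.exp (-(δ / 2 * s₂⁻¹ * u₂)))) :=
        mul_le_mul_of_nonneg_left (mul_le_mul h1 hw (by positivity) (Real.exp_pos _).le) (by positivity)
    _ = K * B₁ * H₂ * (1 + 2 / δ) * s₂ ^ α *
          (Real.exp (-(δ / 2 * s₁⁻¹ * u₁)) * Real.exp (-(δ / 2 * s₂⁻¹ * u₂))) := by ring

/-- **p. 444 [PDF 34]: *"This gives us a convergent expression plus the expression (3.36)"* — quantitative form ON `ηℤ^{d+1}`, PROVED**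
for the two transported terms of (3.34) (`eq334Z`, weights `(η·dist₁)^α`): under the two-scale tree bound
`‖Γ_μ(x,x′,x″)v‖ ≤ Ke^{−δη|x−x′|₁/s₁}e^{−δη|x′−x″|₁/s₂}‖v‖` through the vertex `x′`, Hölder bounds `|gA_μ(x) − gA_μ(x′)| ≤ H₁(η|x−x′|₁)^α`,
`‖φ″(x″) − φ″(x′)‖ ≤ H₂(η|x′−x″|₁)^α` (`0 ≤ α ≤ 1`) and sup bounds `|gA_μ| ≤ B₁`, `‖φ″‖ ≤ B₂` on the localization sets, their sum is at most
`(d+1)·K·(H₁B₂s₁^α + B₁H₂s₂^α)·(1 + 2/δ)·Σ_{x,x′,x″}η^{3(d+1)}‖φ′(x′)‖e^{−½δη|x−x′|₁/s₁}e^{−½δη|x′−x″|₁/s₂}` — the degree-0 majorant of (3.33) times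
the gains `s^α = (L^jη)^α` (degree `+α > 0`: *"convergent"*; p20 g3's torus `abs_convergent334_le` is the one-scale finite-volume twin).
[cite: Balaban1983Higgs3, (3.34) p.443; p.444] -/
theorem abs_convergent334Z_le (η α : ℝ) (hη : 0 < η) {H₁ H₂ B₁ B₂ K δ s₁ s₂ : ℝ} (hα0 : 0 ≤ α) (hα1 : α ≤ 1) (hH₁ : 0 ≤ H₁)
    (hH₂ : 0 ≤ H₂) (hB₁ : 0 ≤ B₁) (hB₂ : 0 ≤ B₂) (hK : 0 ≤ K) (hδ : 0 < δ) (hs₁ : 0 < s₁) (hs₂ : 0 < s₂) (Γ : Kernel3Z d W)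
    (g : (Fin (d + 1) → ℤ) → ℝ) (A : Fin (d + 1) → (Fin (d + 1) → ℤ) → ℝ) (φ' φ'' : (Fin (d + 1) → ℤ) → W)
    (Λ Λ' Λ'' : Finset (Fin (d + 1) → ℤ))
    (hΓ : ∀ (μ : Fin (d + 1)), ∀ x ∈ Λ, ∀ x' ∈ Λ', ∀ x'' ∈ Λ'', ∀ (v : W), ‖Γ μ x x' x'' v‖ ≤
      K * Real.exp (-(δ * s₁⁻¹ * (η * dist₁ x x'))) * Real.exp (-(δ * s₂⁻¹ * (η * dist₁ x' x''))) * ‖v‖)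
    (hgAH : ∀ (μ : Fin (d + 1)), ∀ x ∈ Λ, ∀ x' ∈ Λ', |g x * A μ x - g x' * A μ x'| ≤ H₁ * (η * dist₁ x x') ^ α)
    (hgAB : ∀ (μ : Fin (d + 1)), ∀ x' ∈ Λ', |g x' * A μ x'| ≤ B₁)
    (hφ''H : ∀ x' ∈ Λ', ∀ x'' ∈ Λ'', ‖φ'' x'' - φ'' x'‖ ≤ H₂ * (η * dist₁ x' x'') ^ α)
    (hφ''B : ∀ x'' ∈ Λ'', ‖φ'' x''‖ ≤ B₂) :
    |tripleSumZ η Γ (fun μ x x' => (g x * A μ x - g x' * A μ x') / (η * dist₁ x x') ^ α) φ'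
          (fun x x' x'' => (η * dist₁ x x') ^ α • φ'' x'') Λ Λ' Λ'' +
        tripleSumZ η Γ (fun μ _ x' => g x' * A μ x') φ'
          (fun _ x' x'' => (η * dist₁ x'' x') ^ α • (((η * dist₁ x'' x') ^ α)⁻¹ • (φ'' x'' - φ'' x'))) Λ Λ' Λ''| ≤
      ((d + 1 : ℕ) : ℝ) * (K * (H₁ * B₂ * s₁ ^ α + B₁ * H₂ * s₂ ^ α) * (1 + 2 / δ)) *
        ∑ x ∈ Λ, ∑ x' ∈ Λ', ∑ x'' ∈ Λ'', η ^ (3 * (d + 1)) * (‖φ' x'‖ *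
          (Real.exp (-(δ / 2 * s₁⁻¹ * (η * dist₁ x x'))) * Real.exp (-(δ / 2 * s₂⁻¹ * (η * dist₁ x' x''))))) := by
  have hw : ∀ x x' : Fin (d + 1) → ℤ, (η * (dist₁ x x' : ℝ)) ^ α = 0 → x = x' :=
    fun x x' h => rpow_dist₁_eq_zero hη α x x' h
  rw [tripleSumZ_weight_cancel_first η Γ φ' φ'' (fun x x' => (η * (dist₁ x x' : ℝ)) ^ α) hw
      (fun μ x x' => g x * A μ x - g x' * A μ x') (fun μ x => sub_self _),
    tripleSumZ_weight_cancel_second η Γ _ φ' φ'' (fun x x' => (η * (dist₁ x x' : ℝ)) ^ α) hw]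
  have h1 := abs_tripleSumZ_first_le η hη hα0 hα1 hH₁ hB₂ hK hδ hs₁ hs₂ Γ g A φ' φ'' Λ Λ' Λ'' hΓ hgAH hφ''B
  have h2 := abs_tripleSumZ_second_le η hη hα0 hα1 hB₁ hH₂ hK hδ hs₁ hs₂ Γ g A φ' φ'' Λ Λ' Λ'' hΓ hgAB hφ''H
  set M : ℝ := ∑ x ∈ Λ, ∑ x' ∈ Λ', ∑ x'' ∈ Λ'', η ^ (3 * (d + 1)) * (‖φ' x'‖ *
    (Real.exp (-(δ / 2 * s₁⁻¹ * (η * dist₁ x x'))) * Real.exp (-(δ / 2 * s₂⁻¹ * (η * dist₁ x' x''))))) with hM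
  calc _ ≤ ((d + 1 : ℕ) : ℝ) * (K * H₁ * B₂ * (1 + 2 / δ) * s₁ ^ α) * M +
          ((d + 1 : ℕ) : ℝ) * (K * B₁ * H₂ * (1 + 2 / δ) * s₂ ^ α) * M :=
        (abs_add_le _ _).trans (add_le_add h1 h2)
    _ = ((d + 1 : ℕ) : ℝ) * (K * (H₁ * B₂ * s₁ ^ α + B₁ * H₂ * s₂ ^ α) * (1 + 2 / δ)) * M := by ring

end Convergent

/-! ## §3 p. 444: *"moving all localization functions to the corresponding vertex"* -/

section Move

/-- The kernel of the local (last) term of (3.34) BEFORE the localization functions are moved: the localization function `g₁` of the vertex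
`x` and `g₃` of the vertex `x″` multiply the unrestricted kernel `Γ′_μ(x,x′,x″)` of (3.36) at their own vertices (twin of p20's `locKernel`).
[cite: Balaban1983Higgs3, (3.36) p.444] -/
def locKernelZ (g₁ g₃ : (Fin (d + 1) → ℤ) → ℝ) (Γ' : Kernel3Z d W) : Kernel3Z d W :=
  fun μ x x' x'' => (g₁ x * g₃ x'') • Γ' μ x x' x''

/-- The remainder kernel of the move *"moving all localization functions to the corresponding vertex"*: the difference
`(g₁(x)g₃(x″) − g₁(x′)g₃(x′))Γ′_μ(x,x′,x″)` — the *"convergent expression"* of p. 444 (twin of p20's `moveRem`).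
[cite: Balaban1983Higgs3, (3.36) p.444] -/
def moveRemZ (g₁ g₃ : (Fin (d + 1) → ℤ) → ℝ) (Γ' : Kernel3Z d W) : Kernel3Z d W :=
  fun μ x x' x'' => (g₁ x * g₃ x'' - g₁ x' * g₃ x') • Γ' μ x x' x''

/-- **p. 444 [PDF 34]** ON `ηℤ^{d+1}`, *"We transform further this expression moving all localization functions to the corresponding vertex.
This gives us a convergent expression plus the expression (3.36) … (a product of the values of all the localization functions at the point
x′)"* — the exact identity, PROVED: the local term of (3.34) with the kernel `g₁(x)g₃(x″)Γ′` equals (3.36) with `locs(x′) = g(x′)g₁(x′)g₃(x′)`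
plus the local term with the remainder kernel `moveRemZ`. [cite: Balaban1983Higgs3, (3.36) p.444] -/
theorem local334Z_locKernelZ (η : ℝ) (g₁ g₃ : (Fin (d + 1) → ℤ) → ℝ) (Γ' : Kernel3Z d W) (g : (Fin (d + 1) → ℤ) → ℝ)
    (A : Fin (d + 1) → (Fin (d + 1) → ℤ) → ℝ) (φ' φ'' : (Fin (d + 1) → ℤ) → W) (Λ Λ' Λ'' : Finset (Fin (d + 1) → ℤ)) :
    local334Z η (locKernelZ g₁ g₃ Γ') g A φ' φ'' Λ Λ' Λ'' =
      local336Z η Γ' (fun x' => g x' * (g₁ x' * g₃ x')) A φ' φ'' Λ Λ' Λ'' +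
        local334Z η (moveRemZ g₁ g₃ Γ') g A φ' φ'' Λ Λ' Λ'' := by
  rw [local336Z, ← tripleSumZ_local, ← tripleSumZ_local, ← tripleSumZ_local]
  unfold tripleSumZ
  rw [← Finset.sum_add_distrib]
  refine Finset.sum_congr rfl fun x _ => ?_
  rw [← Finset.sum_add_distrib]
  refine Finset.sum_congr rfl fun x' _ => ?_
  rw [← Finset.sum_add_distrib]
  refine Finset.sum_congr rfl fun x'' _ => ?_
  rw [← mul_add, ← Finset.sum_add_distrib]
  congr 1
  refine Finset.sum_congr rfl fun μ _ => ?_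
  simp only [locKernelZ, moveRemZ, LinearMap.smul_apply, inner_smul_right]
  ring

/-- **p. 444 [PDF 34]**, the *"convergent expression"* of the move ON `ηℤ^{d+1}` — quantitative bound, PROVED: with the two-scale tree bound
`‖Γ′_μ(x,x′,x″)v‖ ≤ Ke^{−δη|x−x′|₁/s₁}e^{−δη|x′−x″|₁/s₂}‖v‖` through the vertex `x′`, the Hölder bounds `|g₁(z) − g₁(z′)| ≤ H₁(η|z−z′|₁)^α`,
`|g₃(z) − g₃(z′)| ≤ H₃(η|z−z′|₁)^α`, the sup bounds `|g₁| ≤ B₁`, `|g₃| ≤ B₃` and `|g(x′)A_μ(x′)| ≤ B`, the local term with the remainder kernel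
gains `s^α`: `|local334Z(moveRemZ g₁ g₃ Γ′)| ≤ (d+1)·K·B·(H₁B₃s₁^α + B₁H₃s₂^α)·(1 + 2/δ)·Σ_{x,x′,x″}η^{3(d+1)}‖φ′(x′)‖‖φ″(x′)‖e^{−½δη|x−x′|₁/s₁}
e^{−½δη|x′−x″|₁/s₂}` (a generalized expression of degree `+α`). [cite: Balaban1983Higgs3, (3.36) p.444] -/
theorem abs_local334Z_moveRemZ_le (η : ℝ) (hη : 0 < η) {α K B H₁ B₁ H₃ B₃ δ s₁ s₂ : ℝ} (hα0 : 0 ≤ α) (hα1 : α ≤ 1)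
    (hK : 0 ≤ K) (hB : 0 ≤ B) (hH₁ : 0 ≤ H₁) (hB₁ : 0 ≤ B₁) (hH₃ : 0 ≤ H₃) (hB₃ : 0 ≤ B₃) (hδ : 0 < δ) (hs₁ : 0 < s₁)
    (hs₂ : 0 < s₂) (Γ' : Kernel3Z d W) (g g₁ g₃ : (Fin (d + 1) → ℤ) → ℝ) (A : Fin (d + 1) → (Fin (d + 1) → ℤ) → ℝ)
    (φ' φ'' : (Fin (d + 1) → ℤ) → W) (Λ Λ' Λ'' : Finset (Fin (d + 1) → ℤ))
    (hΓ : ∀ (μ : Fin (d + 1)), ∀ x ∈ Λ, ∀ x' ∈ Λ', ∀ x'' ∈ Λ'', ∀ (v : W), ‖Γ' μ x x' x'' v‖ ≤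
      K * Real.exp (-(δ * s₁⁻¹ * (η * dist₁ x x'))) * Real.exp (-(δ * s₂⁻¹ * (η * dist₁ x' x''))) * ‖v‖)
    (hgA : ∀ (μ : Fin (d + 1)), ∀ x' ∈ Λ', |g x' * A μ x'| ≤ B)
    (hg₁ : ∀ z z' : Fin (d + 1) → ℤ, |g₁ z - g₁ z'| ≤ H₁ * (η * dist₁ z z') ^ α) (hg₁b : ∀ z, |g₁ z| ≤ B₁)
    (hg₃ : ∀ z z' : Fin (d + 1) → ℤ, |g₃ z - g₃ z'| ≤ H₃ * (η * dist₁ z z') ^ α) (hg₃b : ∀ z, |g₃ z| ≤ B₃) :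
    |local334Z η (moveRemZ g₁ g₃ Γ') g A φ' φ'' Λ Λ' Λ''| ≤
      ((d + 1 : ℕ) : ℝ) * (K * B * (H₁ * B₃ * s₁ ^ α + B₁ * H₃ * s₂ ^ α) * (1 + 2 / δ)) *
        ∑ x ∈ Λ, ∑ x' ∈ Λ', ∑ x'' ∈ Λ'', η ^ (3 * (d + 1)) * (‖φ' x'‖ * (‖φ'' x'‖ *
          (Real.exp (-(δ / 2 * s₁⁻¹ * (η * dist₁ x x'))) * Real.exp (-(δ / 2 * s₂⁻¹ * (η * dist₁ x' x'')))))) := by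
  rw [← tripleSumZ_local]
  refine abs_tripleSumZ_le η hη.le _ _ φ' _ (K * B * (H₁ * B₃ * s₁ ^ α + B₁ * H₃ * s₂ ^ α) * (1 + 2 / δ)) _ Λ Λ' Λ''
    fun μ x hx x' hx' x'' hx'' => ?_
  set u₁ : ℝ := η * dist₁ x x' with hu₁
  set u₂ : ℝ := η * dist₁ x' x'' with hu₂
  have hu₁0 : 0 ≤ u₁ := mul_nonneg hη.le (Nat.cast_nonneg _)
  have hu₂0 : 0 ≤ u₂ := mul_nonneg hη.le (Nat.cast_nonneg _)
  -- the difference of the products of localization functions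
  have hdiff : |g₁ x * g₃ x'' - g₁ x' * g₃ x'| ≤ H₁ * u₁ ^ α * B₃ + B₁ * (H₃ * u₂ ^ α) := by
    have hsplit : g₁ x * g₃ x'' - g₁ x' * g₃ x' = (g₁ x - g₁ x') * g₃ x'' + g₁ x' * (g₃ x'' - g₃ x') := by ring
    rw [hsplit]
    have h3 : |g₃ x'' - g₃ x'| ≤ H₃ * u₂ ^ α := by rw [hu₂, dist₁_comm]; exact hg₃ x'' x'
    calc |(g₁ x - g₁ x') * g₃ x'' + g₁ x' * (g₃ x'' - g₃ x')|
        ≤ |(g₁ x - g₁ x') * g₃ x''| + |g₁ x' * (g₃ x'' - g₃ x')| := abs_add_le _ _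
      _ = |g₁ x - g₁ x'| * |g₃ x''| + |g₁ x'| * |g₃ x'' - g₃ x'| := by rw [abs_mul, abs_mul]
      _ ≤ H₁ * u₁ ^ α * B₃ + B₁ * (H₃ * u₂ ^ α) :=
          add_le_add (mul_le_mul (hg₁ x x') (hg₃b x'') (abs_nonneg _) (by positivity))
            (mul_le_mul (hg₁b x') h3 (abs_nonneg _) hB₁)
  -- the remainder kernel applied to the leg
  have hΓv : ‖moveRemZ g₁ g₃ Γ' μ x x' x'' (φ'' x')‖ ≤ (H₁ * u₁ ^ α * B₃ + B₁ * (H₃ * u₂ ^ α)) *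
      (K * Real.exp (-(δ * s₁⁻¹ * u₁)) * Real.exp (-(δ * s₂⁻¹ * u₂)) * ‖φ'' x'‖) := by
    simp only [moveRemZ, LinearMap.smul_apply, norm_smul, Real.norm_eq_abs]
    exact mul_le_mul hdiff (hΓ μ x hx x' hx' x'' hx'' _) (norm_nonneg _) (by positivity)
  -- the two gains
  have hw₁ := exp_mul_rpow_le hδ hs₁ hu₁0 hα0 hα1
  have hw₂ := exp_mul_rpow_le hδ hs₂ hu₂0 hα0 hα1
  have he₁ := exp_le_exp_half hδ hs₁ hu₁0
  have he₂ := exp_le_exp_half hδ hs₂ hu₂0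
  have hE1 : u₁ ^ α * (Real.exp (-(δ * s₁⁻¹ * u₁)) * Real.exp (-(δ * s₂⁻¹ * u₂))) ≤
      (1 + 2 / δ) * s₁ ^ α * (Real.exp (-(δ / 2 * s₁⁻¹ * u₁)) * Real.exp (-(δ / 2 * s₂⁻¹ * u₂))) := by
    calc u₁ ^ α * (Real.exp (-(δ * s₁⁻¹ * u₁)) * Real.exp (-(δ * s₂⁻¹ * u₂)))
        = (Real.exp (-(δ * s₁⁻¹ * u₁)) * u₁ ^ α) * Real.exp (-(δ * s₂⁻¹ * u₂)) := by ring
      _ ≤ ((1 + 2 / δ) * s₁ ^ α * Real.exp (-(δ / 2 * s₁⁻¹ * u₁))) * Real.exp (-(δ / 2 * s₂⁻¹ * u₂)) :=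
          mul_le_mul hw₁ he₂ (Real.exp_pos _).le (by positivity)
      _ = _ := by ring
  have hE2 : u₂ ^ α * (Real.exp (-(δ * s₁⁻¹ * u₁)) * Real.exp (-(δ * s₂⁻¹ * u₂))) ≤
      (1 + 2 / δ) * s₂ ^ α * (Real.exp (-(δ / 2 * s₁⁻¹ * u₁)) * Real.exp (-(δ / 2 * s₂⁻¹ * u₂))) := by
    calc u₂ ^ α * (Real.exp (-(δ * s₁⁻¹ * u₁)) * Real.exp (-(δ * s₂⁻¹ * u₂)))
        = Real.exp (-(δ * s₁⁻¹ * u₁)) * (Real.exp (-(δ * s₂⁻¹ * u₂)) * u₂ ^ α) := by ring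
      _ ≤ Real.exp (-(δ / 2 * s₁⁻¹ * u₁)) * ((1 + 2 / δ) * s₂ ^ α * Real.exp (-(δ / 2 * s₂⁻¹ * u₂))) :=
          mul_le_mul he₁ hw₂ (by positivity) (Real.exp_pos _).le
      _ = _ := by ring
  set E : ℝ := Real.exp (-(δ / 2 * s₁⁻¹ * u₁)) * Real.exp (-(δ / 2 * s₂⁻¹ * u₂)) with hE
  calc |g x' * A μ x'| * ‖moveRemZ g₁ g₃ Γ' μ x x' x'' (φ'' x')‖
      ≤ B * ((H₁ * u₁ ^ α * B₃ + B₁ * (H₃ * u₂ ^ α)) *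
          (K * Real.exp (-(δ * s₁⁻¹ * u₁)) * Real.exp (-(δ * s₂⁻¹ * u₂)) * ‖φ'' x'‖)) :=
        mul_le_mul (hgA μ x' hx') hΓv (norm_nonneg _) hB
    _ = B * K * ‖φ'' x'‖ * (H₁ * B₃ * (u₁ ^ α * (Real.exp (-(δ * s₁⁻¹ * u₁)) * Real.exp (-(δ * s₂⁻¹ * u₂)))) +
          B₁ * H₃ * (u₂ ^ α * (Real.exp (-(δ * s₁⁻¹ * u₁)) * Real.exp (-(δ * s₂⁻¹ * u₂))))) := by ring
    _ ≤ B * K * ‖φ'' x'‖ * (H₁ * B₃ * ((1 + 2 / δ) * s₁ ^ α * E) + B₁ * H₃ * ((1 + 2 / δ) * s₂ ^ α * E)) := by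
        gcongr
    _ = K * B * (H₁ * B₃ * s₁ ^ α + B₁ * H₃ * s₂ ^ α) * (1 + 2 / δ) * (‖φ'' x'‖ * E) := by ring

end Move

/-! ## §4 The local term is linear in its kernel; the summation of (3.36) over the line indices -/

section Resum

variable {ι : Type*}

/-- kernel: the local term of (3.34)/(3.36) is additive in the kernel. [cite: Balaban1983Higgs3, (3.36) p.444] -/
theorem local334Z_add (η : ℝ) (Γ₁ Γ₂ : Kernel3Z d W) (g : (Fin (d + 1) → ℤ) → ℝ) (A : Fin (d + 1) → (Fin (d + 1) → ℤ) → ℝ)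
    (φ' φ'' : (Fin (d + 1) → ℤ) → W) (Λ Λ' Λ'' : Finset (Fin (d + 1) → ℤ)) :
    local334Z η (Γ₁ + Γ₂) g A φ' φ'' Λ Λ' Λ'' = local334Z η Γ₁ g A φ' φ'' Λ Λ' Λ'' + local334Z η Γ₂ g A φ' φ'' Λ Λ' Λ'' := by
  rw [← tripleSumZ_local, ← tripleSumZ_local, ← tripleSumZ_local]
  simp only [tripleSumZ, Pi.add_apply, LinearMap.add_apply, inner_add_right, mul_add, Finset.sum_add_distrib]

/-- kernel: the local term vanishes for the zero kernel. [cite: Balaban1983Higgs3, (3.36) p.444] -/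
theorem local334Z_zero (η : ℝ) (g : (Fin (d + 1) → ℤ) → ℝ) (A : Fin (d + 1) → (Fin (d + 1) → ℤ) → ℝ)
    (φ' φ'' : (Fin (d + 1) → ℤ) → W) (Λ Λ' Λ'' : Finset (Fin (d + 1) → ℤ)) :
    local334Z η (0 : Kernel3Z d W) g A φ' φ'' Λ Λ' Λ'' = 0 := by
  rw [← tripleSumZ_local]
  simp [tripleSumZ]

/-- kernel: the local term of a finite sum of kernels is the sum of the local terms. [cite: Balaban1983Higgs3, (3.36) p.444] -/
theorem local334Z_finset_sum (η : ℝ) (s : Finset ι) (Γ : ι → Kernel3Z d W) (g : (Fin (d + 1) → ℤ) → ℝ)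
    (A : Fin (d + 1) → (Fin (d + 1) → ℤ) → ℝ) (φ' φ'' : (Fin (d + 1) → ℤ) → W) (Λ Λ' Λ'' : Finset (Fin (d + 1) → ℤ)) :
    local334Z η (∑ i ∈ s, Γ i) g A φ' φ'' Λ Λ' Λ'' = ∑ i ∈ s, local334Z η (Γ i) g A φ' φ'' Λ Λ' Λ'' := by
  classical
  induction s using Finset.induction_on with
  | empty => simp [local334Z_zero]
  | insert i s hi ih => rw [Finset.sum_insert hi, Finset.sum_insert hi, local334Z_add, ih]

/-- kernel: (3.36) of a finite sum of unrestricted kernels is the sum of the (3.36)'s. [cite: Balaban1983Higgs3, (3.36) p.444] -/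
theorem local336Z_finset_sum (η : ℝ) (s : Finset ι) (Γ' : ι → Kernel3Z d W) (locs : (Fin (d + 1) → ℤ) → ℝ)
    (A : Fin (d + 1) → (Fin (d + 1) → ℤ) → ℝ) (φ' φ'' : (Fin (d + 1) → ℤ) → W) (Λ Λ' Λ'' : Finset (Fin (d + 1) → ℤ)) :
    local336Z η (∑ i ∈ s, Γ' i) locs A φ' φ'' Λ Λ' Λ'' = ∑ i ∈ s, local336Z η (Γ' i) locs A φ' φ'' Λ Λ' Λ'' :=
  local334Z_finset_sum η s Γ' locs A φ' φ'' Λ Λ' Λ''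

/-- **p. 444 [PDF 34]** ON `ηℤ^{d+1}`, verbatim: *"Next we sum the expressions (3.36) over admissible orderings and indices and we get the
expressions of the same type but with propagators G^η_{j₀}(0), G^η_{j₀}, where j₀ is the lowest index of the external legs."* — PROVED in the
generality of the printed *"expressions of the same type"*: for every MULTILINEAR dependence `Φ` of the unrestricted kernel `Γ′` on the
kernels of the `m` internal lines, and the decompositions (2.6) `G_l = Σ_{j<j₀} G_l^{(j)}` of the line propagators (`B3.Display26`; for the
pieces of `G_k(ηℤ^{d+1},0)` this is p26's `B3Ineq314ZeroLattice.sum_gpieceZ_range`), the sum of (3.36) over all index assignments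
`(j_1, …, j_m) ∈ [0, j₀)^m` is (3.36) with the propagators `G_l`. [cite: Balaban1983Higgs3, (3.36) p.444] -/
theorem local336Z_resum (η : ℝ) {m j₀ : ℕ} (Φ : MultilinearMap ℝ (fun _ : Fin m => KernelZ d) (Kernel3Z d W))
    {G : Fin m → KernelZ d} {Gfam : Fin m → ℕ → KernelZ d} (h : ∀ l, B3.Display26 (G l) (Gfam l) j₀)
    (locs : (Fin (d + 1) → ℤ) → ℝ) (A : Fin (d + 1) → (Fin (d + 1) → ℤ) → ℝ) (φ' φ'' : (Fin (d + 1) → ℤ) → W)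
    (Λ Λ' Λ'' : Finset (Fin (d + 1) → ℤ)) :
    ∑ r ∈ Fintype.piFinset (fun _ : Fin m => Finset.range j₀), local336Z η (Φ fun l => Gfam l (r l)) locs A φ' φ'' Λ Λ' Λ'' =
      local336Z η (Φ G) locs A φ' φ'' Λ Λ' Λ'' := by
  have hG : G = fun l => ∑ i ∈ Finset.range j₀, Gfam l i := funext fun l => h l
  rw [hG, MultilinearMap.map_sum_finset, local336Z_finset_sum]

/-- The three-line shape of the unrestricted kernel for the triangle graphs (2.20): `Γ′_μ(x,x′,x″) = K₁(x,x′)K₂(x′,x″)K₃(x,x″)·T_μ` with the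
three line kernels `K₁` (line `x–x′`), `K₂` (line `x′–x″`), `K₃` (line `x–x″`) and a fixed map `T_μ` of the internal indices (charge matrices;
twin of p20's `triKernel`). [cite: Balaban1983Higgs3, (3.36) p.444] -/
def triKernelZ (T : Fin (d + 1) → W →ₗ[ℝ] W) (K₁ K₂ K₃ : KernelZ d) : Kernel3Z d W :=
  fun μ x x' x'' => (K₁ x x' * K₂ x' x'' * K₃ x x'') • T μ

/-- kernel: the three-line shape is trilinear in the line kernels — with the decompositions (2.6) of the three lines it splits into the
triple sum over their indices. [cite: Balaban1983Higgs3, (3.36) p.444] -/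
theorem triKernelZ_sum {ι₁ ι₂ ι₃ : Type*} (s₁ : Finset ι₁) (s₂ : Finset ι₂) (s₃ : Finset ι₃) (T : Fin (d + 1) → W →ₗ[ℝ] W)
    (K₁ : ι₁ → KernelZ d) (K₂ : ι₂ → KernelZ d) (K₃ : ι₃ → KernelZ d) :
    triKernelZ T (∑ i ∈ s₁, K₁ i) (∑ i ∈ s₂, K₂ i) (∑ i ∈ s₃, K₃ i) =
      ∑ i₁ ∈ s₁, ∑ i₂ ∈ s₂, ∑ i₃ ∈ s₃, triKernelZ T (K₁ i₁) (K₂ i₂) (K₃ i₃) := by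
  funext μ x x' x''
  simp only [triKernelZ, Finset.sum_apply, Finset.sum_mul, Finset.mul_sum, Finset.sum_smul]
  calc ∑ k ∈ s₃, ∑ i₂ ∈ s₂, ∑ i ∈ s₁, (K₁ i x x' * K₂ i₂ x' x'' * K₃ k x x'') • T μ
      = ∑ i₂ ∈ s₂, ∑ k ∈ s₃, ∑ i ∈ s₁, (K₁ i x x' * K₂ i₂ x' x'' * K₃ k x x'') • T μ := Finset.sum_comm
    _ = ∑ i₂ ∈ s₂, ∑ i ∈ s₁, ∑ k ∈ s₃, (K₁ i x x' * K₂ i₂ x' x'' * K₃ k x x'') • T μ :=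
        Finset.sum_congr rfl fun _ _ => Finset.sum_comm
    _ = ∑ i ∈ s₁, ∑ i₂ ∈ s₂, ∑ k ∈ s₃, (K₁ i x x' * K₂ i₂ x' x'' * K₃ k x x'') • T μ := Finset.sum_comm

/-- **p. 444 [PDF 34]** ON `ηℤ^{d+1}`, the resummation of (3.36) for the three-line (triangle) shape: summing over the indices
`j, j′, j″ < j₀` of the three internal lines gives (3.36) with the resummed propagators (`B3.Display26`: `G_l = Σ_{i<j₀} G_l^{(i)}`).
[cite: Balaban1983Higgs3, (3.36) p.444] -/
theorem local336Z_triKernelZ_resum (η : ℝ) {j₀ : ℕ} (T : Fin (d + 1) → W →ₗ[ℝ] W) {G₁ G₂ G₃ : KernelZ d}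
    {F₁ F₂ F₃ : ℕ → KernelZ d} (h₁ : B3.Display26 G₁ F₁ j₀) (h₂ : B3.Display26 G₂ F₂ j₀) (h₃ : B3.Display26 G₃ F₃ j₀)
    (locs : (Fin (d + 1) → ℤ) → ℝ) (A : Fin (d + 1) → (Fin (d + 1) → ℤ) → ℝ) (φ' φ'' : (Fin (d + 1) → ℤ) → W)
    (Λ Λ' Λ'' : Finset (Fin (d + 1) → ℤ)) :
    ∑ i₁ ∈ Finset.range j₀, ∑ i₂ ∈ Finset.range j₀, ∑ i₃ ∈ Finset.range j₀,
        local336Z η (triKernelZ T (F₁ i₁) (F₂ i₂) (F₃ i₃)) locs A φ' φ'' Λ Λ' Λ'' =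
      local336Z η (triKernelZ T G₁ G₂ G₃) locs A φ' φ'' Λ Λ' Λ'' := by
  rw [h₁, h₂, h₃, triKernelZ_sum, local336Z_finset_sum]
  refine Finset.sum_congr rfl fun i₁ _ => ?_
  rw [local336Z_finset_sum]
  refine Finset.sum_congr rfl fun i₂ _ => ?_
  rw [local336Z_finset_sum]

/-- kernel: **the tree bound of a triangle kernel through the vertex `x′` from line bounds** — if `|K₁(x,x′)| ≤ C₁e^{−δη|x−x′|₁/s₁}`,
`|K₂(x′,x″)| ≤ C₂e^{−δη|x′−x″|₁/s₂}`, `|K₃(x,x″)| ≤ C₃` and `‖T_μv‖ ≤ Q‖v‖`, then `‖Γ′_μ(x,x′,x″)v‖ ≤ (QC₁C₂C₃)e^{−δη|x−x′|₁/s₁}e^{−δη|x′−x″|₁/s₂}‖v‖`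
(the hypothesis `hΓ` of §2/§3; the decay of the third line is not needed). [cite: Balaban1983Higgs3, (2.10) p.426, (3.36) p.444] -/
theorem norm_triKernelZ_le {η δ s₁ s₂ C₁ C₂ C₃ Q : ℝ} (hC₁ : 0 ≤ C₁) (hC₂ : 0 ≤ C₂) (hC₃ : 0 ≤ C₃)
    (T : Fin (d + 1) → W →ₗ[ℝ] W) (K₁ K₂ K₃ : KernelZ d) (hT : ∀ (μ : Fin (d + 1)) (v : W), ‖T μ v‖ ≤ Q * ‖v‖)
    {x x' x'' : Fin (d + 1) → ℤ} (hK₁ : |K₁ x x'| ≤ C₁ * Real.exp (-(δ * s₁⁻¹ * (η * dist₁ x x'))))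
    (hK₂ : |K₂ x' x''| ≤ C₂ * Real.exp (-(δ * s₂⁻¹ * (η * dist₁ x' x'')))) (hK₃ : |K₃ x x''| ≤ C₃) (μ : Fin (d + 1)) (v : W) :
    ‖triKernelZ T K₁ K₂ K₃ μ x x' x'' v‖ ≤
      Q * C₁ * C₂ * C₃ * Real.exp (-(δ * s₁⁻¹ * (η * dist₁ x x'))) * Real.exp (-(δ * s₂⁻¹ * (η * dist₁ x' x''))) * ‖v‖ := by
  simp only [triKernelZ, LinearMap.smul_apply, norm_smul, Real.norm_eq_abs, abs_mul]
  have h12 : |K₁ x x'| * |K₂ x' x''| ≤ (C₁ * Real.exp (-(δ * s₁⁻¹ * (η * dist₁ x x')))) *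
      (C₂ * Real.exp (-(δ * s₂⁻¹ * (η * dist₁ x' x'')))) := mul_le_mul hK₁ hK₂ (abs_nonneg _) (by positivity)
  have h123 : |K₁ x x'| * |K₂ x' x''| * |K₃ x x''| ≤ (C₁ * Real.exp (-(δ * s₁⁻¹ * (η * dist₁ x x')))) *
      (C₂ * Real.exp (-(δ * s₂⁻¹ * (η * dist₁ x' x'')))) * C₃ := mul_le_mul h12 hK₃ (abs_nonneg _) (by positivity)
  calc |K₁ x x'| * |K₂ x' x''| * |K₃ x x''| * ‖T μ v‖
      ≤ (C₁ * Real.exp (-(δ * s₁⁻¹ * (η * dist₁ x x')))) * (C₂ * Real.exp (-(δ * s₂⁻¹ * (η * dist₁ x' x'')))) * C₃ *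
          (Q * ‖v‖) := mul_le_mul h123 (hT μ v) (norm_nonneg _) (by positivity)
    _ = _ := by ring

end Resum

end

end Literature.MathematicalPhysics.QuantumFieldTheory.Balaban1983to89.B3Eq334ZeroLattice
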